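import Summits.SmoothPoincare4.SmoothPoincare4.Theorems.CongruenceShadowsNormalFormStablyTrivialSketchTransfer

/-!
# Line `Sketch` for crux `NormalFormStablyTrivial` (stmt-SmoothPoincare4-14591) — skeleton (v2)

Registered skeleton of the line `Sketch` (crux idea `primitive-reducing-systems`, ideator 2;
`PICKED.md`, `Lines/Sketch.md`).  Version 2: the two stub statements and the composition now live
in the tree (`Theorems/CongruenceShadowsNormalFormStablyTrivialSketchTransfer.lean`, p89648), so the
skeleton only names them.

**Stubs** (registered; `sorry` only here):
* `stub_stablyThreeHandleFree : StablyThreeHandleFree` (K1, HARDEST, lead) — kernel form of Kirby 4.18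
  for homotopy 4-spheres: after `n` stabilisations a normalised `(3+3m, m+1)` trisection of `{1}` is
  `Iso` to `K'' # eyes (m+1+n) j` (one-direction connected sum).  Calibrated at `K = N`
  (`…SketchCalibration.lean`, `…SketchConsequences.lean`: AGK's `X` ⇒ K1).
* `stub_threeHandleFreeStablyTrivial : ThreeHandleFreeStablyTrivial` (K2) — `Iso`-closed kernel
  form of "gsc homotopy 4-spheres are `S⁴`" (weak generalised Property R); worker verdict
  `stub-blocked` on `NoOneHandles.NoohGscStandard`; AGK's `X` ⇒ K2
  (`threeHandleFreeStablyTrivial_of_agkCondition`).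

**Composition**: `NormalFormStablyTrivial_of` = the landed `transfer_normalFormStablyTrivial`
(cast bookkeeping, Nielsen-free because K2 is `Iso`-closed).

**Disproof.lean honoured (cycle 1)**: §3 (`triple` load-bearing) — both stubs carry
`IsGroupTrisection … PUnit`; §5(i)(ii) never claimed; `-- Targets`: none posted against this line yet.
-/

-- the prescribed namespace `Summit.<P>.<Sub>.…` duplicates `SmoothPoincare4` (P = Sub)
set_option linter.dupNamespace false

noncomputable section

namespace Summit.SmoothPoincare4.SmoothPoincare4.Cruxes.NormalFormStablyTrivial.Sketch

open Summit.SmoothPoincare4.SmoothPoincare4.Theses.CongruenceShadows (NormalFormStablyTrivial)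
open Summit.SmoothPoincare4.SmoothPoincare4.Theorems.NormalFormStablyTrivial.Sketch
  (StablyThreeHandleFree ThreeHandleFreeStablyTrivial transfer_normalFormStablyTrivial)

/-! ## The registered stubs -/

/-- STUB K1 (hardest; lead). -/
theorem stub_stablyThreeHandleFree : StablyThreeHandleFree := by
  sorry

/-- STUB K2. -/
theorem stub_threeHandleFreeStablyTrivial : ThreeHandleFreeStablyTrivial := by
  sorry

/-! ## The composition (no `sorry` below this line) -/

/-- **K1 ∧ K2 ⇒ the crux** (the landed transfer). -/
theorem NormalFormStablyTrivial_of (h1 : StablyThreeHandleFree) (h2 : ThreeHandleFreeStablyTrivial) :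
    NormalFormStablyTrivial :=
  transfer_normalFormStablyTrivial h1 h2

/-- The skeleton closes the crux modulo the two registered stubs. -/
theorem normalFormStablyTrivial_skeleton : NormalFormStablyTrivial :=
  NormalFormStablyTrivial_of stub_stablyThreeHandleFree stub_threeHandleFreeStablyTrivial

end Summit.SmoothPoincare4.SmoothPoincare4.Cruxes.NormalFormStablyTrivial.Sketch

end
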